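import Summits.HodgeConjecture.HodgeConjecture.Theorems.MarkmanPartnerTransportPicardThreeK3SquaresCycleInducedSector
import Summits.HodgeConjecture.HodgeConjecture.Theorems.BoundaryReadoutPullbackAlgebraic
import Literature.AlgebraicGeometry.HodgeTheory.AlgebraicClassesExteriorProduct
import Literature.AlgebraicGeometry.HodgeTheory.GysinBaseChange
import Literature.AlgebraicGeometry.Surfaces.K3RealMultiplicationCycleInduced

/-!
# Route MarkmanPartnerTransport · crux `PicardThreeK3Squares` (stmt-HodgeConjecture-19652) —
# rung `SquareOfGenerator` (stub F4 of line `cm-anchor-spread`), PROVED: the Hodge conjecture for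
# `S × S` when `End_Hdg(T(S))` is generated by a cycle-induced endomorphism

The line `cm-anchor-spread` (planner p1, cell hodge-nonav) on the real-multiplication third of the
crux isolates the bookkeeping rung F4 `SquareOfGenerator`: *if a rational endomorphism `t` of
`H²(S(ℂ); ℂ)` killing `N = N¹H²` is induced by an algebraic class on `S × S` and every rational Hodge
endomorphism killing `N` with image in `T = N^⊥` is a rational polynomial in `t` on `T`, then the Hodge
conjecture holds for `S ⊗ S`* — Varesco's "HC for `S²` ⟺ `End_Hdg(T(S))` algebraic" over `ℚ[t]`.
It is LITERALLY the hypothesis `hF4` of the tree consumer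
`IsCycleInducedRMK3.hodgeConjectureFor_tensor_self_of`
(`Literature/AlgebraicGeometry/Surfaces/K3RealMultiplicationCycleInduced`), whose instances are the
van Geemen–Schütt 2025 families of K3 surfaces with real multiplication induced by an explicit cycle.

* `cupProduct_mem_algebraicClasses_tripleProduct` — `N² ∪ N² ⊆ N⁴` on triple products of surfaces
  (diagonal pull-back of the exterior product with the PROVED `fulton1998_map_mem_algebraicClasses_holds`,
  as in the tree's theorem `Voisin2003_cupProduct_algebraicClasses_holds`);
* `exists_algebraicClass_pow_of_corrFst` — powers of a cycle-induced endomorphism are cycle-induced: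
  the diagonal acts as the identity (`corrFst_diagonal`) and algebraic correspondences between surfaces
  compose (`corrComp_surfaces_of_cup`, Fulton Prop. 16.1.1 with the PROVED Gysin base change);
* `squareOfGenerator` — the rung F4 / hypothesis `hF4`, PROVED from
  `CycleInducedSector.hodgeConjectureFor_square_of_cycleInducedSector` (`Σᵢ aᵢ tⁱ` is `N`-stable and
  cycle-induced);
* `hodgeConjectureFor_tensor_self_of_isCycleInducedRMK3` — **the Hodge conjecture for `S × S` for
  every K3 surface with real multiplication whose generator is cycle-induced** (`IsCycleInducedRMK3`),
  unconditionally; `hodgeConjectureFor_tensor_self_of_generated` (the same from the two clauses);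
  `exists_rmK3_hodgeConjectureFor_square_of_exists` / `exists_rmK3_sqrt2_hodgeConjectureFor_square` —
  under the van Geemen–Schütt existence facts, RM K3 squares OUTSIDE the Kuga–Satake / CM sector
  satisfying HC (van Geemen 2008: "not a single non-trivial example known" — now six families, in the
  tree, modulo the typed existence of their very general members).

No definition, no sorry; the only named fact appears as the hypothesis of the last corollary. Prover
seat hodge-nonav-19652-p1 (gen 0), `--supports stmt-HodgeConjecture-19652`.

References: Varesco (2023), §2 p. 8; van Geemen–Schütt, Forum Math. Sigma 13 (2025) e2, §4.8,
Rem. 4.9, Thm. 1.1, Thm. 1.2; Fulton, *Intersection Theory*, Prop. 16.1.1; Voisin II, Prop. 9.20.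
-/

set_option linter.dupNamespace false

noncomputable section

namespace Summit.HodgeConjecture.HodgeConjecture.Theorems.MarkmanPartnerTransport.SquareOfGenerator

open scoped Manifold
open CategoryTheory MonoidalCategory CartesianMonoidalCategory Polynomial
open Literature.AlgebraicGeometry Literature.AlgebraicGeometry.Motives Literature.AlgebraicGeometry.HodgeTheory
open Literature.AlgebraicGeometry.Surfaces
open Literature.AlgebraicTopology.SingularHomology
open Summit.HodgeConjecture.HodgeConjecture.Theorems.NikulinTwinTransport
open Summit.HodgeConjecture.HodgeConjecture.Theorems.MarkmanPartnerTransport.CycleInducedSector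

variable {S : SchemeOver ℂ}

/-- `Corr[μ, hS ; γ, y] = pr₁_*(pr₂^* y ∪ γ)` on `H²(S(ℂ); ℂ)` — the action of a class
`γ ∈ H⁴((S ⊗ S)(ℂ))` (as in `IsCycleInducedTranscendentalEndomorphism`). Local notation only. -/
local notation3 (prettyPrint := false) "Corr[" μ ", " hS " ; " γ ", " y "]" =>
  complexGysin μ (IsSmoothProjective.tensor_holds hS hS) hS
    (SemiCartesianMonoidalCategory.fst _ _) (rfl : 2 * 1 + 2 * 2 + 2 * 2 = 2 * 1 + 2 * (2 + 2))
    (cupProduct (rfl : 2 * 1 + 2 * 2 = 2 * 1 + 2 * 2)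
      (complexBetti.map (SemiCartesianMonoidalCategory.snd _ _) (2 * 1) y) γ)

/-! ### Powers of a cycle-induced endomorphism are cycle-induced -/

/-- **`N² ∪ N² ⊆ N⁴` on a triple product of smooth projective surfaces** — the multiplicativity input
`hCUP` of `corrComp_surfaces_of_cup`: cup products of algebraic classes are algebraic on every smooth
projective variety (as in the tree's theorem `Voisin2003_cupProduct_algebraicClasses_holds`: diagonal
pull-back of the exterior product, `cupProduct_mem_algebraicClasses_of_forall_map_diagonal`, with the
PROVED pull-back theorem `fulton1998_map_mem_algebraicClasses_holds`).
[cite: VoisinHodgeII2003, §9.2.4 Prop. 9.20] [cite: Fulton1998, §19.2 Cor. 19.2 (b)] -/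
theorem cupProduct_mem_algebraicClasses_tripleProduct (A B C : SchemeOver ℂ)
    (hA : IsSmoothProjective 2 A) (hB : IsSmoothProjective 2 B) (hC : IsSmoothProjective 2 C) :
    ∀ a ∈ algebraicClasses (A ⊗ (B ⊗ C)) 2, ∀ b ∈ algebraicClasses (A ⊗ (B ⊗ C)) 2,
      cupProduct ((Nat.mul_add 2 2 2).symm : 2 * 2 + 2 * 2 = 2 * (2 + 2)) a b ∈
        algebraicClasses (A ⊗ (B ⊗ C)) (2 + 2) :=
  fun _ ha _ hb ↦ cupProduct_mem_algebraicClasses_of_forall_map_diagonal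
    (fun _ _ hW p _ hc ↦ fulton1998_map_mem_algebraicClasses_holds (lift (𝟙 _) (𝟙 _))
      (IsSmoothProjective.tensor_holds hW hW) hW p _ hc)
    (IsSmoothProjective.tensor_holds hA (IsSmoothProjective.tensor_holds hB hC)) 2 2 ha hb

/-- **Powers of an endomorphism of `H²(S)` induced by an algebraic class on `S × S` are induced by
algebraic classes**: `t⁰ = id = [Δ]_*` (`corrFst_diagonal`, `diagonal_mem_algebraicClasses`) and
`tⁱ⁺¹ = tⁱ ∘ t = [γᵢ ∘ γ]_*` by the composition of algebraic correspondences between surfaces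
(`corrComp_surfaces_of_cup`, Fulton Prop. 16.1.1: `π₁₃_*(π₁₂^* α ∪ π₂₃^* β)` is algebraic, the Gysin
base change proved in the tree, multiplicativity by `cupProduct_mem_algebraicClasses_tripleProduct`).
[cite: Fulton1998, §16.1 Prop. 16.1.1] [cite: GeemenSchutt2023, §4.8] -/
theorem exists_algebraicClass_pow_of_corrFst (μ : OrientationFamily) (hS : IsSmoothProjective 2 S)
    (t : complexBetti S (2 * 1) →ₗ[ℂ] complexBetti S (2 * 1))
    (hγt : ∃ γ ∈ algebraicClasses (S ⊗ S) 2, ∀ y : complexBetti S (2 * 1), t y = Corr[μ, hS ; γ, y])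
    (i : ℕ) :
    ∃ γ ∈ algebraicClasses (S ⊗ S) 2, ∀ y : complexBetti S (2 * 1),
      (t ^ i) y = Corr[μ, hS ; γ, y] := by
  obtain ⟨γ, hγalg, hγ⟩ := hγt
  induction i with
  | zero =>
    refine ⟨complexGysin μ hS (IsSmoothProjective.tensor_holds hS hS) (lift (𝟙 S) (𝟙 S))
        (rfl : 0 + 2 * (2 + 2) = 2 * 2 + 2 * 2) (singularCohomology.one ℂ (ComplexPoints S)),
      diagonal_mem_algebraicClasses μ hS _, fun y ↦ ?_⟩
    rw [pow_zero, Module.End.one_apply]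
    exact (corrFst_diagonal μ hS (rfl : 2 * 1 + 2 * 2 = 2 * 1 + 2 * 2)
      (rfl : 2 * 1 + 2 * 2 + 2 * 2 = 2 * 1 + 2 * (2 + 2)) (rfl : 0 + 2 * (2 + 2) = 2 * 2 + 2 * 2) y).symm
  | succ i ih =>
    obtain ⟨γi, hγialg, hγi⟩ := ih
    obtain ⟨γ₂, hγ₂alg, hγ₂⟩ := corrComp_surfaces_of_cup μ cupProduct_mem_algebraicClasses_tripleProduct
      S S S hS hS hS γi hγialg γ hγalg
    refine ⟨γ₂, hγ₂alg, fun y ↦ ?_⟩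
    rw [pow_succ, Module.End.mul_apply, hγ y, hγi]
    exact (hγ₂ y).symm

/-! ### The rung F4 `SquareOfGenerator` -/

/-- **Rung F4 `SquareOfGenerator` of line `cm-anchor-spread` (crux `PicardThreeK3Squares`,
stmt-HodgeConjecture-19652), PROVED** — Varesco's Künneth bookkeeping over `ℚ[t]`: for a smooth
projective complex surface `S` and a `ℂ`-linear endomorphism `t` of `H²(S(ℂ); ℂ)` preserving rational
classes, killing `N = N¹H²`, induced by an algebraic class on `S × S` (`t = pr₁_*(pr₂^*(–) ∪ γ)` for the
complex orientation family), such that every rational Hodge endomorphism killing `N` with image `⊥ N`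
is a rational polynomial in `t` on `T` (`TranscendentalEndomorphismsGeneratedBy S t`, VERBATIM the
line's `GeneratesClause`), the Hodge conjecture holds for `S ⊗ S`. This is LITERALLY the hypothesis
`hF4` of `IsCycleInducedRMK3.hodgeConjectureFor_tensor_self_of`. Proof: `Σᵢ aᵢ tⁱ` is `N`-stable
(`t` kills `N`) and cycle-induced (`exists_algebraicClass_pow_of_corrFst`, linearity), so
`hodgeConjectureFor_square_of_cycleInducedSector` applies. (The rationality of `t` is part of the
registered signature and is not needed by the proof.) [cite: Varesco2023, §2 (p. 8)]
[cite: GeemenSchutt2023, §4.8 and Rem. 4.9] [cite: Fulton1998, §16.1 Prop. 16.1.1] -/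
theorem squareOfGenerator (S : SchemeOver ℂ) (hS : IsSmoothProjective 2 S)
    (t : complexBetti S (2 * 1) →ₗ[ℂ] complexBetti S (2 * 1))
    (_ht_rat : ∀ y, IsRationalClass y → IsRationalClass (t y))
    (ht_N : ∀ d ∈ algebraicClasses S 1, t d = 0)
    (hγt : ∃ γ ∈ algebraicClasses (S ⊗ S) 2, ∀ y : complexBetti S (2 * 1),
      t y = complexGysin complexOrientationFamily (IsSmoothProjective.tensor_holds hS hS) hS
        (SemiCartesianMonoidalCategory.fst S S)
        (rfl : 2 * 1 + 2 * 2 + 2 * 2 = 2 * 1 + 2 * (2 + 2))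
        (cupProduct (rfl : 2 * 1 + 2 * 2 = 2 * 1 + 2 * 2)
          (complexBetti.map (SemiCartesianMonoidalCategory.snd S S) (2 * 1) y) γ))
    (hgen : TranscendentalEndomorphismsGeneratedBy S t) :
    HodgeConjectureFor 4 (S ⊗ S) := by
  refine hodgeConjectureFor_square_of_cycleInducedSector complexOrientationFamily hS
    fun f hf₁ hf₂ hf₃ hf₄ ↦ ?_
  obtain ⟨n, a, ha⟩ := hgen f hf₁ hf₂ hf₃ hf₄
  have hpow := fun i : ℕ ↦ exists_algebraicClass_pow_of_corrFst complexOrientationFamily hS t hγt i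
  choose γ hγalg hγ using hpow
  refine ⟨∑ i : Fin n, ((a i : ℚ) : ℂ) • t ^ (i : ℕ), fun d hd ↦ ?_,
    ⟨∑ i : Fin n, ((a i : ℚ) : ℂ) • γ i,
      Submodule.sum_mem _ fun i _ ↦ Submodule.smul_mem _ _ (hγalg i), fun y ↦ ?_⟩, fun y hy ↦ ?_⟩
  · -- `N`-stability: `t⁰ d = d`, `tⁱ⁺¹ d = tⁱ (t d) = 0`
    rw [LinearMap.sum_apply]
    refine Submodule.sum_mem _ fun i _ ↦ ?_
    rw [LinearMap.smul_apply]
    refine Submodule.smul_mem _ _ ?_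
    cases hi : (i : ℕ) with
    | zero =>
      rw [pow_zero, Module.End.one_apply]
      exact hd
    | succ m =>
      rw [pow_succ, Module.End.mul_apply, ht_N d hd, map_zero]
      exact Submodule.zero_mem _
  · -- the class `Σᵢ aᵢ γᵢ`
    rw [LinearMap.sum_apply, map_sum, map_sum]
    refine Finset.sum_congr rfl fun i _ ↦ ?_
    rw [LinearMap.smul_apply, map_smul, map_smul, hγ]
  · rw [ha y hy, LinearMap.sum_apply]
    refine Finset.sum_congr rfl fun i _ ↦ ?_
    rw [LinearMap.smul_apply]

/-! ### Consequences: real-multiplication K3 squares with cycle-induced generator -/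

/-- **The Hodge conjecture for `S × S` for every K3 surface with real multiplication whose generator is
induced by an algebraic cycle** (`IsCycleInducedRMK3 S ρ P`: `S` a K3 surface of Picard number `ρ`, not
of CM type, with a cycle-induced transcendental endomorphism `t`, `P(t) = 0` on `T`, generating
`End_Hdg(T_{S,ℚ})`): the consumer `IsCycleInducedRMK3.hodgeConjectureFor_tensor_self_of` with its
hypothesis `hF4` DISCHARGED by `squareOfGenerator`. Real-multiplication K3 squares OUTSIDE the
Kuga–Satake / CM sector (van Geemen–Schütt 2025, Rem. 4.9: "Assuming the Hodge conjecture, there must be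
a cycle inducing the RM" — here conversely the cycle gives the Hodge conjecture for the square).
[cite: GeemenSchutt2023, §4.8 and Rem. 4.9] [cite: Varesco2023, §2 (p. 8)] -/
theorem hodgeConjectureFor_tensor_self_of_isCycleInducedRMK3 {ρ : ℕ} {P : ℚ[X]}
    (h : IsCycleInducedRMK3 S ρ P) : HodgeConjectureFor 4 (S ⊗ S) :=
  h.hodgeConjectureFor_tensor_self_of fun S hS t h₁ h₂ h₃ h₄ ↦ squareOfGenerator S hS t h₁ h₂ h₃ h₄

/-- **The RM third of the crux `PicardThreeK3Squares` on the cycle-induced sector**: for a projective K3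
surface `S` carrying a cycle-induced transcendental endomorphism `t` (`IsCycleInducedTranscendentalEndomorphism`)
that generates the rational Hodge endomorphisms of `T(S)` (`TranscendentalEndomorphismsGeneratedBy S t`),
the Hodge conjecture holds for `S ⊗ S` — at every Picard rank, with no CM / Kuga–Satake input.
[cite: GeemenSchutt2023, §4.8] [cite: Varesco2023, §2 (p. 8)] -/
theorem hodgeConjectureFor_tensor_self_of_generated (hS : IsK3Surface S)
    (t : complexBetti S (2 * 1) →ₗ[ℂ] complexBetti S (2 * 1))
    (ht : IsCycleInducedTranscendentalEndomorphism S hS.isSmoothProjective t)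
    (hgen : TranscendentalEndomorphismsGeneratedBy S t) :
    HodgeConjectureFor 4 (S ⊗ S) := by
  obtain ⟨hrat, -, hNS, -, γ, hγ, hcorr⟩ := ht
  exact squareOfGenerator S hS.isSmoothProjective t hrat hNS ⟨γ, hγ, hcorr⟩ hgen

/-- **RM K3 squares satisfying the Hodge conjecture, outside the Kuga–Satake / CM sector** — the
shape of the six van Geemen–Schütt existence facts `VanGeemenSchuett2025_rmK3_cycleInduced_*`
(`∃ S, IsCycleInducedRMK3 S ρ P`) upgraded: such a family member is a K3 surface of Picard number `ρ`,
NOT of CM type, with real multiplication `ℚ[t|_T] ≅ ℚ[X]/(P)` induced by a cycle, AND its square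
satisfies the Hodge conjecture. [cite: GeemenSchutt2023, Thm. 1.1, Thm. 1.2, §4.8] -/
theorem exists_rmK3_hodgeConjectureFor_square_of_exists {ρ : ℕ} {P : ℚ[X]}
    (h : ∃ S : SchemeOver ℂ, IsCycleInducedRMK3 S ρ P) :
    ∃ S : SchemeOver ℂ, IsK3Surface S ∧ Module.finrank ℂ ↥(algebraicClasses S 1) = ρ ∧
      ¬ HasComplexMultiplication S ∧ IsCycleInducedRMK3 S ρ P ∧ HodgeConjectureFor 4 (S ⊗ S) := by
  obtain ⟨S, h⟩ := h
  exact ⟨S, h.isK3Surface, h.finrank_algebraicClasses_one, h.not_hasComplexMultiplication, h,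
    hodgeConjectureFor_tensor_self_of_isCycleInducedRMK3 h⟩

/-- **Example (van Geemen–Schütt, Thm. 1.2 (2)): a K3 surface of Picard number `10` with real
multiplication by `ℚ(√2)` induced by a degree-`2` rational self-map, not of CM type, whose square
satisfies the Hodge conjecture** — conditional exactly on the existence fact
`VanGeemenSchuett2025_rmK3_cycleInduced_sqrt2`; the facts `_zeta7`, `_zeta9`, `_zeta11`, `_sqrt5`,
`_sqrt3` give the analogous statements at `ρ = 4, 10, 2, 6, 10` by the same one-line proof
(`exists_rmK3_hodgeConjectureFor_square_of_exists`). [cite: GeemenSchutt2023, Thm. 1.2 (2) and §6.4] -/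
theorem exists_rmK3_sqrt2_hodgeConjectureFor_square (h : VanGeemenSchuett2025_rmK3_cycleInduced_sqrt2) :
    ∃ S : SchemeOver ℂ, IsK3Surface S ∧ Module.finrank ℂ ↥(algebraicClasses S 1) = 10 ∧
      ¬ HasComplexMultiplication S ∧ IsCycleInducedRMK3 S 10 (X ^ 2 - 2) ∧
      HodgeConjectureFor 4 (S ⊗ S) :=
  exists_rmK3_hodgeConjectureFor_square_of_exists h

end Summit.HodgeConjecture.HodgeConjecture.Theorems.MarkmanPartnerTransport.SquareOfGenerator

end
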